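import Literature.Analysis.FluidPDE.WeakSolution
import Mathlib.Analysis.InnerProductSpace.PiL2
import Mathlib.Analysis.Calculus.Deriv.Mul
import Mathlib.Analysis.Calculus.Deriv.Pow
import Mathlib.Analysis.Calculus.Deriv.Prod
import Mathlib.Analysis.Calculus.Deriv.Comp
import HarnessLib.Audit

/-!
# Crux `ExtremalTypeIConstant.ExtremalSpiralSymmetry` (stmt-NavierStokesRegularity-8215), line
  `registered`: STUB `stub_generatorOfFamily` — the spiral-scaling generator of a symmetry family

Lands `--supports stmt-NavierStokesRegularity-8215` the registered stub `stub_generatorOfFamily` of the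
lead's skeleton `Cruxes/ExtremalSpiralSymmetry/Lines/birth.lean` (pure chain rule, Mathlib only).

If `u : ℝ → ℝ³ → ℝ³` is differentiable on the open slab `t < 0` and `s ↦ (c s, R s, b s)` is a family of
exact rigid parabolic scaling symmetries of `u`,
`c s • u ((c s)² t, c s • x) = R s (u t (Q s (x - b s)))` for all `s`, all `t < 0` and all `x`, passing
through the identity at `s = 0` (`c 0 = 1`, `b 0 = 0`, `R 0 = Q 0 = id`) and differentiable there with
`ċ(0) = 1`, `ḃ(0) = a`, `Ṙ(0) = A`, `Q̇(0) = -A`, then differentiating the identity in `s` at `s = 0`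
gives the infinitesimal spiral-scaling symmetry `∇u·(a + x + Ax) + u + 2t ∂ₜu − Au = 0`.

Proof. Fix `t < 0` and `x`. The uncurried field `U = uncurry u` is differentiable at `(t, x)` (the slab is
open); let `L = DU(t, x)`. The partials are `D(u t)(x) v = L (0, v)` and `∂ₜu (t, x) = L (1, 0)`. The left
side `s ↦ c s • U ((c s)² t, c s • x)` has derivative `L (2t, x) + u t x` at `0`; the right side
`s ↦ R s (u t (Q s (x - b s)))` has derivative `A (u t x) + L (0, -a - A x)` (`HasDerivAt.clm_apply` twice).
The two functions coincide, so the derivatives agree (`HasDerivAt.unique`); linearity of `L` rearranges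
this to the claim.
-/

noncomputable section

set_option linter.dupNamespace false

namespace Summit.NavierStokesRegularity.NavierStokesRegularity.Theorems.ExtremalSpiralSymmetry.Registered

open Literature.Analysis.FluidPDE Set Function

/-- Local notation for physical space `ℝ³`. -/
local notation "E3" => EuclideanSpace ℝ (Fin 3)

/-- **STUB `stub_generatorOfFamily` — the generator of a differentiable family of rigid scaling
symmetries** (chain rule). If `u` is differentiable on the open slab `t < 0` and
`c s • u ((c s)² t, c s • x) = R s (u t (Q s (x - b s)))` for all `s`, `t < 0`, `x`, with
`c 0 = 1`, `b 0 = 0`, `R 0 = Q 0 = id`, `ċ(0) = 1`, `ḃ(0) = a`, `Ṙ(0) = A`, `Q̇(0) = -A`, then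
`∇u·(a + x + Ax) + u + 2t ∂ₜu − Au = 0` on `t < 0`. -/
theorem stub_generatorOfFamily :
    ∀ (u : ℝ → E3 → E3), DifferentiableOn ℝ (Function.uncurry u) (Set.Iio 0 ×ˢ Set.univ) →
      ∀ (c : ℝ → ℝ) (b : ℝ → E3) (R Q : ℝ → (E3 →L[ℝ] E3)) (a : E3) (A : E3 →L[ℝ] E3),
        c 0 = 1 → b 0 = 0 → R 0 = ContinuousLinearMap.id ℝ E3 → Q 0 = ContinuousLinearMap.id ℝ E3 →
        HasDerivAt c 1 0 → HasDerivAt b a 0 → HasDerivAt R A 0 → HasDerivAt Q (-A) 0 →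
        (∀ s : ℝ, ∀ t < 0, ∀ x, c s • u (c s ^ 2 * t) (c s • x) = R s (u t (Q s (x - b s)))) →
        ∀ t < 0, ∀ x, fderiv ℝ (u t) x (a + x + A x) + u t x +
          (2 * t) • Literature.Analysis.FluidPDE.timeDeriv u t x - A (u t x) = 0 := by
  intro u hU c b R Q a A hc0 hb0 hR0 hQ0 hc hb hR hQ hfam t ht x
  -- the uncurried field is differentiable at `(t, x)`, the slab being open
  have hmem : (t, x) ∈ Set.Iio (0 : ℝ) ×ˢ (Set.univ : Set E3) := Set.mk_mem_prod ht (Set.mem_univ x)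
  have hopen : IsOpen (Set.Iio (0 : ℝ) ×ˢ (Set.univ : Set E3)) := isOpen_Iio.prod isOpen_univ
  have hUF : HasFDerivAt (Function.uncurry u) (fderiv ℝ (Function.uncurry u) (t, x)) (t, x) :=
    (hU.differentiableAt (hopen.mem_nhds hmem)).hasFDerivAt
  set L : ℝ × E3 →L[ℝ] E3 := fderiv ℝ (Function.uncurry u) (t, x)
  -- the spatial partial `S v = L (0, v)` and the time partial `T = L (1, 0)`
  set S : E3 →L[ℝ] E3 := L.comp (ContinuousLinearMap.inr ℝ ℝ E3)
  have hSv : ∀ v : E3, S v = L (0, v) := fun v => rfl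
  have hLrv : ∀ (r : ℝ) (v : E3), L (r, v) = r • L (1, 0) + S v := by
    intro r v
    have hsplit : ((r, v) : ℝ × E3) = r • ((1 : ℝ), (0 : E3)) + ((0 : ℝ), v) := by
      ext <;> simp
    rw [hsplit, map_add, map_smul, hSv]
  have hux : HasFDerivAt (u t) S x := hUF.comp x (hasFDerivAt_prodMk_right t x)
  have hut : HasDerivAt (fun s => u s x) (L (1, 0)) t := by
    have h := HasFDerivAt.comp_hasDerivAt t hUF ((hasDerivAt_id t).prodMk (hasDerivAt_const t x))
    exact h
  -- derivative of the left side `s ↦ c s • u ((c s)² t, c s • x)` at `s = 0`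
  have hp1 : HasDerivAt (fun s => c s ^ 2 * t) (2 * t) 0 := by
    refine ((hc.fun_pow 2).mul_const t).congr_deriv ?_
    simp [hc0]
  have hp2 : HasDerivAt (fun s => c s • x) x 0 := by
    simpa using hc.smul_const x
  have hp : HasDerivAt (fun s => (c s ^ 2 * t, c s • x)) (2 * t, x) 0 := hp1.prodMk hp2
  have hp0 : ((c 0 ^ 2 * t, c 0 • x) : ℝ × E3) = (t, x) := by simp [hc0]
  have hUF' : HasFDerivAt (Function.uncurry u) L (c 0 ^ 2 * t, c 0 • x) := by
    rw [hp0]; exact hUF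
  have hUp : HasDerivAt (fun s => u (c s ^ 2 * t) (c s • x)) (L (2 * t, x)) 0 := by
    have h := HasFDerivAt.comp_hasDerivAt 0 hUF' hp
    exact h
  have hφ : HasDerivAt (fun s => c s • u (c s ^ 2 * t) (c s • x))
      (c 0 • L (2 * t, x) + (1 : ℝ) • u (c 0 ^ 2 * t) (c 0 • x)) 0 :=
    hc.fun_smul hUp
  -- derivative of the right side `s ↦ R s (u t (Q s (x - b s)))` at `s = 0`
  have hxb : HasDerivAt (fun s => x - b s) (-a) 0 := hb.const_sub x
  have hq : HasDerivAt (fun s => Q s (x - b s)) ((-A) (x - b 0) + Q 0 (-a)) 0 := hQ.clm_apply hxb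
  have hq0 : Q 0 (x - b 0) = x := by simp [hQ0, hb0]
  have hux' : HasFDerivAt (u t) S (Q 0 (x - b 0)) := by
    rw [hq0]; exact hux
  have hw : HasDerivAt (fun s => u t (Q s (x - b s))) (S ((-A) (x - b 0) + Q 0 (-a))) 0 := by
    have h := HasFDerivAt.comp_hasDerivAt 0 hux' hq
    exact h
  have hψ : HasDerivAt (fun s => R s (u t (Q s (x - b s))))
      (A (u t (Q 0 (x - b 0))) + R 0 (S ((-A) (x - b 0) + Q 0 (-a)))) 0 :=
    hR.clm_apply hw
  -- the two sides coincide, hence so do their derivatives at `0`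
  have hfun : (fun s => c s • u (c s ^ 2 * t) (c s • x)) = fun s => R s (u t (Q s (x - b s))) :=
    funext fun s => hfam s t ht x
  rw [hfun] at hφ
  have key := hφ.unique hψ
  simp only [hc0, hb0, hR0, hQ0, one_smul, one_pow, one_mul, sub_zero, ContinuousLinearMap.id_apply,
    neg_apply, map_add, map_neg] at key
  -- identify the partials in the goal and conclude by linearity
  have hfd : fderiv ℝ (u t) x = S := hux.fderiv
  have htd : Literature.Analysis.FluidPDE.timeDeriv u t x = L (1, 0) := by
    rw [Literature.Analysis.FluidPDE.timeDeriv_apply]; exact hut.deriv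
  rw [hfd, htd, map_add, map_add]
  rw [hLrv] at key
  linear_combination (norm := abel) key

end Summit.NavierStokesRegularity.NavierStokesRegularity.Theorems.ExtremalSpiralSymmetry.Registered
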